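import Summits.BirchSwinnertonDyer.BirchSwinnertonDyer.Theorems.SlopeDichotomyA2DegenerateLocusA2RegulatorFloor
import Literature.NumberTheory.EllipticCurves.Greenberg1999.MuInvariantParity
import HarnessLib

/-!
# The regulator-floor face of corner A2 from PUBLISHED inputs only: `μ_an = 0` on type B is
# Greenberg–Vatsal Thm. (1.3) + Greenberg Prop. 5.10, so «`λ_an = 1 ⇒ ord_p Reg_p + ord_p ∏c_ℓ ≤ −1`»
# and «floor ⇒ `λ_an ≥ 3`» need no `μ`-certificate

Support file (prover seat `bsd-schneider-i1-c2`, gen 5, cell `bsd-schneider-ideate`; `--supports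
stmt-BirchSwinnertonDyer-19086`), companion of `…DegenerateLocusA2RegulatorFloor.lean` (p448248). There the
`μ_an = 0` input of §§2–3 is the cell's per-pair certificate `AnalyticMuLE W p 0`. On corner A2 (type B =
Greenberg–Vatsal parity) it is a THEOREM IN PRINT: Greenberg, LNM 1716 (1999) Prop. 5.10 (`X(E/ℚ_∞)` is
`Λ`-torsion with `μ = 0` under GV parity; tree fact `Greenberg1999.prop510_isTorsion_hasUnitContent_of_gvPar`)
and Greenberg–Vatsal 2000 Thm. (1.3) (`char X = (g)` with `ι g = ϖ·L_p(f,α)`; tree fact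
`GreenbergVatsal2000.thm13_charIdeal_eq_of_gvPar`) give a generator of unit content whose image is the
Néron-normalised `p`-adic `L`-function, i.e. `AnalyticMuLE W p 0` (`analyticMuLE_zero_of_typeBRankOne`, §1).
§2 restates the two headline theorems of the companion file with this discharge: granted ONLY published
named facts (W16, Perrin-Riou–Schneider = BMS Thm. 1.7, GV Thm. 1.3, Greenberg Prop. 5.10, Mazur–Tate σ,
modularity, GZK), on corner A2 **`λ_an = 1` forces `Reg_p ≠ 0` and `ord_p Reg_p + ord_p ∏c_ℓ ≤ −1`**
for THE canonical regulator, and **the regulator–Tamagawa floor AT THE PAIR excludes `λ_an = 1` and makes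
any certified `λ_an ≥ 3`** (memo ROUTE-P3-v8 (T1) modulo (T3)-at-the-pair, published-inputs form).
THEOREMS ONLY; nothing is booked; the floor stays a per-pair hypothesis (class-wide it is the memo's
H-int + E4, a Literature typing task — FINDING-i1-c2-g5 §3).

References: [GreenbergLNM1716] Prop. 5.10 (PDF p. 147); [GreenbergVatsal2000] Thm. (1.3), p. 2 (1)–(2);
[BalakrishnanMullerStein2015] Thm. 1.7; [Wuthrich2014] Thm. 16; cell memo ROUTE-P3-v8-lambda-g10 §1.
-/

set_option autoImplicit false

noncomputable section

open scoped Classical MatrixGroups ModularForm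

open PowerSeries CongruenceSubgroup WeierstrassCurve Literature.NumberTheory.EllipticCurves
  Literature.NumberTheory.EllipticCurves.ModularForms
  Literature.NumberTheory.EllipticCurves.Rank1Residual
  Literature.NumberTheory.EllipticCurves.Greenberg1999
  Summit.BirchSwinnertonDyer.Rank1Residual
  Summit.BirchSwinnertonDyer.BirchSwinnertonDyer.Theorems.Rank1ResidualX1Defs
  Summit.BirchSwinnertonDyer.Rank1Residual.X1.MuLambda
  Summit.BirchSwinnertonDyer.Rank1Residual.X1.MuPart
  Summit.BirchSwinnertonDyer.Rank1Residual.X1.ParitySqueeze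
  Summit.BirchSwinnertonDyer.BirchSwinnertonDyer.Theses
  Summit.BirchSwinnertonDyer.BirchSwinnertonDyer.Theorems
  Summit.BirchSwinnertonDyer.BirchSwinnertonDyer.Theorems.DegenerateLocusA2RegulatorFloor

-- `Summit.BirchSwinnertonDyer.BirchSwinnertonDyer.…`: the summit and its single sub-problem share a name (D-0017 layout).
set_option linter.dupNamespace false

namespace Summit.BirchSwinnertonDyer.BirchSwinnertonDyer.Theorems.DegenerateLocusA2RegulatorFloorPub

variable {W : WeierstrassCurve ℚ} [W.IsElliptic] [W.IsGloballyMinimal] {p : ℕ} [Fact p.Prime]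

/-! ## §1. `μ_an = 0` on corner A2 from Greenberg Prop. 5.10 + Greenberg–Vatsal Thm. (1.3) -/

/-- **`μ_an = 0` at every pair of Greenberg–Vatsal parity (good ordinary `p ≠ 2`), from PUBLISHED facts.**
Greenberg–Vatsal Thm. (1.3) (`hGV`): `char_Λ X(E/ℚ_∞) = (g)` with `ι g = ϖ·L_p(f,α)` (Néron normalisation);
Greenberg LNM 1716 Prop. 5.10 (`h510`): every generator of `char_Λ X(E/ℚ_∞)` has unit content (`μ = 0`).
Hence some coefficient of `ϖ·L_p(f,α) = ι g` is a `p`-adic unit: the cell's typed certificate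
`AnalyticMuLE W p 0` holds with no computation. [cite: GreenbergVatsal2000, Thm. (1.3) and p. 2 (2)]
[cite: GreenbergLNM1716, Prop. 5.10 (PDF p. 147)] -/
theorem analyticMuLE_zero_of_gvPar (hGV : GreenbergVatsal2000.thm13_charIdeal_eq_of_gvPar)
    (h510 : prop510_isTorsion_hasUnitContent_of_gvPar)
    (hp : p ≠ 2) (hgood : W.HasGoodReductionAtPrime p) (hord : ¬ (p : ℤ) ∣ W.frobeniusTrace p)
    (hpar : GVPar W p) : AnalyticMuLE W p 0 := by
  intro _ f hf ϖ hϖ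
  have hpP : p.Prime := Fact.out
  obtain ⟨κ, hκ, γ, hγ, hγ'⟩ := exists_isCyclotomic_isTopGenerator_isCyclotomicVariable_holds p
  obtain ⟨D⟩ := W.nonempty_selmerDualData_holds κ γ hγ
  obtain ⟨-, g, hchar, hιg⟩ := hGV W p hp hgood hord hpar κ γ hκ hγ hγ' f hf ϖ hϖ D
  have hug : GreenbergVatsal2000.HasUnitContent g :=
    prop510_isTorsion_hasUnitContent_of_gvPar.hasUnitContent_of_charIdeal_eq h510 W p hp
      (Or.inl ⟨hgood, hord⟩) hpar hκ hγ D hchar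
  obtain ⟨n, hn⟩ := (GreenbergVatsal2000.hasUnitContent_iff_exists_norm_coeff_map_eq_one g).mp hug
  refine ⟨n, ?_⟩
  rw [← hιg, hn, Nat.cast_zero, zero_add, zpow_neg, zpow_one]
  exact inv_lt_one_of_one_lt₀ (by exact_mod_cast hpP.one_lt)

/-- **`μ_an = 0` on corner A2** (`X1.TypeBRankOne`: GV parity at a good ordinary anomalous `p > 2`),
from Greenberg–Vatsal Thm. (1.3) + Greenberg Prop. 5.10. [cite: GreenbergVatsal2000, Thm. (1.3)]
[cite: GreenbergLNM1716, Prop. 5.10 (PDF p. 147)] -/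
theorem analyticMuLE_zero_of_typeBRankOne (hGV : GreenbergVatsal2000.thm13_charIdeal_eq_of_gvPar)
    (h510 : prop510_isTorsion_hasUnitContent_of_gvPar) (hB : X1.TypeBRankOne W p) :
    AnalyticMuLE W p 0 :=
  have hX := isClassX1_of_classX1 hB.1
  analyticMuLE_zero_of_gvPar hGV h510 hX.two_ne hX.hasGoodReductionAtPrime hX.not_dvd_frobeniusTrace hB.2.2

/-! ## §2. The companion file's A2 theorems with the `μ`-certificate discharged (published inputs only) -/

/-- **On corner A2, `λ_an = 1` forces `Reg_p ≠ 0` and `ord_p Reg_p + ord_p ∏c_ℓ ≤ −1` for THE canonical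
regulator — PUBLISHED inputs only** (W16, Perrin-Riou–Schneider, GV Thm. 1.3, Greenberg Prop. 5.10,
modularity, GZK; the one per-pair datum is the certificate `λ_an = 1` itself). So the unit-coefficient
road P₁ meets A2 only inside the locus where the canonical regulator has a pole deeper than the Tamagawa
product (empty by the memo's H-int + E4; empty on the 2 797-pair census).
[cite: BalakrishnanMullerStein2015, Thm. 1.7] [cite: GreenbergVatsal2000, Thm. (1.3)]
[cite: GreenbergLNM1716, Prop. 5.10 (PDF p. 147)] [cite: Wuthrich2014, Thm. 16 (p. 393)] -/
theorem valuation_padicRegulator_add_le_of_typeBRankOne_of_analyticLambdaEq_one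
    (hW16 : Wuthrich2014.charIdeal_dvd_padicLFunction) (hS : Schneider1985_order_charGenerator_odd)
    (hGV : GreenbergVatsal2000.thm13_charIdeal_eq_of_gvPar)
    (h510 : prop510_isTorsion_hasUnitContent_of_gvPar)
    (hmodP : nonempty_modularParametrizationData) (hGZK : rank_eq_analyticRank_of_analyticRank_le_one)
    (hB : X1.TypeBRankOne W p) (hlam1 : AnalyticLambdaEq W p 1)
    {Dh : PAdicHeightData W p} (hDh : Dh.IsCanonical) :
    padicRegulator Dh ≠ 0 ∧
      (padicRegulator Dh).valuation + (padicValNat p W.tamagawaProduct : ℤ) ≤ -1 :=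
  DegenerateLocusA2RegulatorFloor.valuation_padicRegulator_add_le_of_typeBRankOne_of_muZero_of_analyticLambdaEq_one
    hW16 hS hmodP hGZK hB (analyticMuLE_zero_of_typeBRankOne hGV h510 hB) hlam1 hDh

/-- **Memo T-λ3 (T1) modulo the floor AT THE PAIR, published-inputs form: on corner A2 the
regulator–Tamagawa floor `Reg_p ≠ 0 → 0 ≤ ord_p Reg_p + ord_p ∏c_ℓ` (THE canonical datum) excludes
`λ_an = 1`.** [cite: GreenbergVatsal2000, Thm. (1.3)] [cite: GreenbergLNM1716, Prop. 5.10 (PDF p. 147)]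
[cite: BalakrishnanMullerStein2015, Thm. 1.7] [cite: Wuthrich2014, Thm. 16 (p. 393)] -/
theorem not_analyticLambdaEq_one_of_typeBRankOne_of_regTamFloor
    (hW16 : Wuthrich2014.charIdeal_dvd_padicLFunction) (hS : Schneider1985_order_charGenerator_odd)
    (hGV : GreenbergVatsal2000.thm13_charIdeal_eq_of_gvPar)
    (h510 : prop510_isTorsion_hasUnitContent_of_gvPar) (hMT : mazur_tate_sigma_exists_odd)
    (hmodP : nonempty_modularParametrizationData) (hGZK : rank_eq_analyticRank_of_analyticRank_le_one)
    (hB : X1.TypeBRankOne W p)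
    (hRT : ∀ Dh : PAdicHeightData W p, Dh.IsCanonical → padicRegulator Dh ≠ 0 →
      0 ≤ (padicRegulator Dh).valuation + (padicValNat p W.tamagawaProduct : ℤ)) :
    ¬ AnalyticLambdaEq W p 1 :=
  DegenerateLocusA2RegulatorFloor.not_analyticLambdaEq_one_of_typeBRankOne_of_regTamFloor hW16 hS hMT
    hmodP hGZK hB (analyticMuLE_zero_of_typeBRankOne hGV h510 hB) hRT

/-- **T-λ3 modulo the floor, published-inputs form: on corner A2, under the regulator–Tamagawa floor at
the pair, a certified `λ_an = n` has `n ≥ 3`.** [cite: GreenbergVatsal2000, Thm. (1.3)]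
[cite: GreenbergLNM1716, Prop. 5.10 (PDF p. 147)] [cite: MazurTateTeitelbaum1986Invent, §I.17–I.18]
[cite: BalakrishnanMullerStein2015, Thm. 1.7] -/
theorem three_le_of_analyticLambdaEq_of_typeBRankOne_of_regTamFloor
    (hW16 : Wuthrich2014.charIdeal_dvd_padicLFunction) (hS : Schneider1985_order_charGenerator_odd)
    (hGV : GreenbergVatsal2000.thm13_charIdeal_eq_of_gvPar)
    (h510 : prop510_isTorsion_hasUnitContent_of_gvPar) (hMT : mazur_tate_sigma_exists_odd)
    (hmodP : nonempty_modularParametrizationData) (hGZK : rank_eq_analyticRank_of_analyticRank_le_one)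
    (hB : X1.TypeBRankOne W p)
    (hRT : ∀ Dh : PAdicHeightData W p, Dh.IsCanonical → padicRegulator Dh ≠ 0 →
      0 ≤ (padicRegulator Dh).valuation + (padicValNat p W.tamagawaProduct : ℤ))
    {n : ℕ} (hn : AnalyticLambdaEq W p n) : 3 ≤ n :=
  DegenerateLocusA2RegulatorFloor.three_le_of_analyticLambdaEq_of_typeBRankOne_of_regTamFloor hW16 hS
    hMT hmodP hGZK hB (analyticMuLE_zero_of_typeBRankOne hGV h510 hB) hRT hn

/-- **Item 19086 on `{λ_an = 1}` is vacuous, published-inputs form**: an A2 pair with `λ_an = 1` has no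
degenerate canonical datum (every canonical `Reg_p ≠ 0`), so `DegenerateLocusA2` holds there trivially;
the content of 19086 lives on `{λ_an ≥ 3}` (companion files, gens 4–5).
[cite: GreenbergVatsal2000, Thm. (1.3)] [cite: BalakrishnanMullerStein2015, Thm. 1.7] -/
theorem degenerateLocusA2_on_lamOne
    (hW16 : Wuthrich2014.charIdeal_dvd_padicLFunction) (hS : Schneider1985_order_charGenerator_odd)
    (hGV : GreenbergVatsal2000.thm13_charIdeal_eq_of_gvPar)
    (h510 : prop510_isTorsion_hasUnitContent_of_gvPar)
    (hmodP : nonempty_modularParametrizationData) (hGZK : rank_eq_analyticRank_of_analyticRank_le_one)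
    (W : WeierstrassCurve ℚ) [W.IsElliptic] [W.IsGloballyMinimal] (p : ℕ) [Fact p.Prime]
    (hB : X1.TypeBRankOne W p) (hlam1 : AnalyticLambdaEq W p 1)
    (hdeg : ∃ Dh : PAdicHeightData W p, Dh.IsCanonical ∧ ¬ SchneiderConjecture Dh) : BSDp W p :=
  DegenerateLocusA2RegulatorFloor.degenerateLocusA2_on_lamOne hW16 hS hmodP hGZK W p hB
    (analyticMuLE_zero_of_typeBRankOne hGV h510 hB) hlam1 hdeg

end Summit.BirchSwinnertonDyer.BirchSwinnertonDyer.Theorems.DegenerateLocusA2RegulatorFloorPub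

end
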